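import Summits.KontsevichZagierPeriods.KontsevichZagierPeriods.Theorems.SymplecticScissorsTypeAGenerationStubRoomLemmaIter

/-!
# `TypeAGeneration` (stmt-KontsevichZagierPeriods-18392), line `Sketch`, stub `stub_roomLemma_of` (S6):
THE ROOM LEMMA of the radius amplification engine

Registered stub `stub_roomLemma_of` of the crux `TypeAGeneration` (route SymplecticScissors, line
`Sketch` = card stokes-compiler, Ayoub 2015 Conj. 1.1): if the transposition certificate (S1), the
room-step congruence (S2), the substituted-series facts (S3), the face-map facts (S4) and the
dilated-piece facts (S5) hold as registered, then for every `R` every `F ∈ 𝒪_{k-alg}(𝔻̄^∞)` is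
congruent, modulo the `k`-span of the type-(a) elements `∂G/∂zᵢ − G|_{zᵢ=1} + G|_{zᵢ=0}`, to some
`P ∈ 𝒪_{k-alg}(𝔻̄^∞)` of polyradius `> R`.

Proof (bookkeeping over the landed one-direction iteration `s6_iter` of
`SymplecticScissorsTypeAGenerationStubRoomLemmaIter.lean`): `s6_axis` amplifies one direction `i`
(choose a rational `μ < min(1/2, (ρᵢ − 1)/(2 max(R,1)))`, so that `0 < μ < 1`, `μ < ρᵢ − 1` and the
fresh pieces get weight `(ρᵢ − 1)/μ > R`, and `m` with `ρᵢ (1−μ)^{-m} > R`); `s6_axes` runs over the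
variables `0, …, N−1` of `F`; the final passage to an isotropic radius is `s6_iso`. The hypothesis S1
is not needed (fresh variables are never renamed back). With S1–S5 landed this closes the engine;
the composition `TypeAGeneration_of` then only waits on the residual `stub_residual`.

References: Ayoub, Ann. of Math. 181 (2015) Conj. 1.1, Rem. 1.2 (unboundedly many auxiliary
variables — here one fresh variable per room step), Rem. 1.5; Fresán 2024 Rem. 3.7.
-/

noncomputable section

-- `Summit.KontsevichZagierPeriods.KontsevichZagierPeriods.…` is the tree's mandated layout (single-conjunct summit).
set_option linter.dupNamespace false

namespace Summit.KontsevichZagierPeriods.KontsevichZagierPeriods.TypeAGenerationLine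

open Finsupp MvPowerSeries
open Literature.NumberTheory.Transcendental
open Literature.NumberTheory.Transcendental.AyoubRel
open Summit.KontsevichZagierPeriods.KontsevichZagierPeriods.Theses.SymplecticScissors (TypeAGeneration)

section Main

variable
  (h2 : ∀ (k : Type) [Field k] [CharZero k] (σ : k →+* ℂ) (F : CSeries), F ∈ Oan σ →
      ∀ (i j : ℕ), i ≠ j → ¬ UsesVar F j → ∀ (μ : ℚ),
        MvPowerSeries.subst
            (fun l : ℕ => if l = i then (X i - C ((μ : ℚ) : ℂ) * (X i * X j) : CSeries) else X l) F ∈ Oan σ →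
        F - ((((1 - μ : ℚ) : ℂ)) • MvPowerSeries.rescale (Function.update (1 : ℕ → ℂ) i ((1 - μ : ℚ) : ℂ)) F
              + ((μ : ℚ) : ℂ) • restrC i 1
                  (MvPowerSeries.subst
                    (fun l : ℕ => if l = i then (X i - C ((μ : ℚ) : ℂ) * (X i * X j) : CSeries) else X l) F)) ∈
          kSpan σ {x : CSeries | ∃ G ∈ Oan σ, ∃ n : ℕ, x = relAC n G})
  (h3 : ∀ (k : Type) [Field k] [CharZero k] (σ : k →+* ℂ) (F : CSeries), F ∈ Oan σ →
      ∀ (ρ : ℕ → ℝ), (∀ l, 1 < ρ l) →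
        Summable (fun a : ℕ →₀ ℕ => ‖MvPowerSeries.coeff a F‖ * a.prod fun l n => ρ l ^ n) →
      ∀ (i j : ℕ), i ≠ j → ¬ UsesVar F j →
      ∀ (μ : ℚ), 0 < μ → ((μ : ℝ) < ρ i - 1) →
        MvPowerSeries.subst
            (fun l : ℕ => if l = i then (X i - C ((μ : ℚ) : ℂ) * (X i * X j) : CSeries) else X l) F ∈ Oan σ ∧
        (∀ θi θj : ℝ, 0 ≤ θi → 0 ≤ θj → θi * (1 + (μ : ℝ) * θj) ≤ ρ i →
          Summable (fun a : ℕ →₀ ℕ =>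
            ‖MvPowerSeries.coeff a (MvPowerSeries.subst
              (fun l : ℕ => if l = i then (X i - C ((μ : ℚ) : ℂ) * (X i * X j) : CSeries) else X l) F)‖ *
              a.prod fun l n => (Function.update (Function.update ρ i θi) j θj) l ^ n)) ∧
        (∀ l : ℕ, UsesVar (MvPowerSeries.subst
            (fun l : ℕ => if l = i then (X i - C ((μ : ℚ) : ℂ) * (X i * X j) : CSeries) else X l) F) l →
          l = j ∨ UsesVar F l))
  (h4 : ∀ (k : Type) [Field k] [CharZero k] (σ : k →+* ℂ) (G : CSeries), G ∈ Oan σ → ∀ (i : ℕ),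
      restrC i 1 G ∈ Oan σ ∧ ¬ UsesVar (restrC i 1 G) i ∧
      (∀ l : ℕ, UsesVar (restrC i 1 G) l → UsesVar G l) ∧
      (∀ ρ : ℕ → ℝ, (∀ l, 1 ≤ ρ l) →
        Summable (fun a : ℕ →₀ ℕ => ‖MvPowerSeries.coeff a G‖ * a.prod fun l n => ρ l ^ n) →
        Summable (fun a : ℕ →₀ ℕ =>
          ‖MvPowerSeries.coeff a (restrC i 1 G)‖ * a.prod fun l n => ρ l ^ n)))
  (h5 : ∀ (k : Type) [Field k] [CharZero k] (σ : k →+* ℂ) (F : CSeries), F ∈ Oan σ →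
      ∀ (ρ : ℕ → ℝ), (∀ l, 1 < ρ l) →
        Summable (fun a : ℕ →₀ ℕ => ‖MvPowerSeries.coeff a F‖ * a.prod fun l n => ρ l ^ n) →
      ∀ (i : ℕ) (μ : ℚ), 0 < μ → μ < 1 →
        MvPowerSeries.rescale (Function.update (1 : ℕ → ℂ) i ((1 - μ : ℚ) : ℂ)) F ∈ Oan σ ∧
        Summable (fun a : ℕ →₀ ℕ =>
          ‖MvPowerSeries.coeff a (MvPowerSeries.rescale (Function.update (1 : ℕ → ℂ) i ((1 - μ : ℚ) : ℂ)) F)‖ *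
            a.prod fun l n => (Function.update ρ i (ρ i / (1 - (μ : ℝ)))) l ^ n) ∧
        (∀ l : ℕ, UsesVar (MvPowerSeries.rescale (Function.update (1 : ℕ → ℂ) i ((1 - μ : ℚ) : ℂ)) F) l →
          UsesVar F l))

variable {k : Type} [Field k] [CharZero k] (σ : k →+* ℂ)

include h2 h3 h4 h5 in
/-- **One direction amplified.** From `D ∈ 𝒪_{k-alg}(𝔻̄^∞)` with weights `ρ > 1` and variables
`< N`, `i < N`: a congruent `P` with weight `> R` at `i` and at the fresh variables `N, …, N' − 1`,
the other weights below `N` unchanged. Choice of the rational `0 < μ < min(1/2, (ρᵢ−1)/(2 max(R,1)))`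
and of `m` with `ρᵢ (1−μ)^{-m} > R`, then `s6_iter`. [cite: Ayoub2015, Rem. 1.5] -/
theorem s6_axis (R : ℝ) (D : CSeries) (hD : D ∈ Oan σ) (ρ : ℕ → ℝ) (hρ : ∀ l, 1 < ρ l)
    (hws : Summable fun a : ℕ →₀ ℕ => ‖coeff a D‖ * a.prod fun l n => ρ l ^ n)
    (N : ℕ) (hN : ∀ l, UsesVar D l → l < N) (i : ℕ) (hi : i < N) :
    ∃ (P : CSeries) (ρ' : ℕ → ℝ) (N' : ℕ), P ∈ Oan σ ∧ (∀ l, 1 < ρ' l) ∧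
      (Summable fun a : ℕ →₀ ℕ => ‖coeff a P‖ * a.prod fun l n => ρ' l ^ n) ∧ N ≤ N' ∧
      (∀ l, UsesVar P l → l < N') ∧ (∀ l, l < N → l ≠ i → ρ' l = ρ l) ∧ R < ρ' i ∧
      (∀ l, N ≤ l → l < N' → R < ρ' l) ∧
      D - P ∈ kSpan σ {x : CSeries | ∃ G ∈ Oan σ, ∃ n : ℕ, x = relAC n G} := by
  -- the parameters `μ` and `m`
  set B : ℝ := max R 1 with hB_def
  have hB1 : 1 ≤ B := le_max_right _ _
  have hB0 : 0 < B := one_pos.trans_le hB1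
  have hRB : R ≤ B := le_max_left _ _
  have hρi : 1 < ρ i := hρ i
  have hc0 : (0 : ℝ) < min (1 / 2) ((ρ i - 1) / (2 * B)) :=
    lt_min (by norm_num) (div_pos (by linarith) (by positivity))
  obtain ⟨μ, hμ0r, hμc⟩ := exists_rat_btwn hc0
  have hμ0 : 0 < μ := by exact_mod_cast hμ0r
  have hμhalf : (μ : ℝ) < 1 / 2 := hμc.trans_le (min_le_left _ _)
  have hμ1 : μ < 1 := by
    have : (μ : ℝ) < 1 := by linarith
    exact_mod_cast this
  have hμB : (μ : ℝ) < (ρ i - 1) / (2 * B) := hμc.trans_le (min_le_right _ _)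
  have hμB' : (μ : ℝ) * (2 * B) < ρ i - 1 := by rwa [lt_div_iff₀ (by positivity)] at hμB
  have hμρ : (μ : ℝ) < ρ i - 1 := by nlinarith
  have hΘR : R < (ρ i - 1) / (μ : ℝ) := by
    rw [lt_div_iff₀ hμ0r]
    nlinarith
  have hΘ1 : 1 < (ρ i - 1) / (μ : ℝ) := by
    rw [one_lt_div hμ0r]; linarith
  have hlam0 : (0 : ℝ) < 1 - μ := by linarith
  have hlam1 : 1 - (μ : ℝ) < 1 := by linarith
  obtain ⟨m, hm⟩ := exists_pow_lt_of_lt_one (div_pos (zero_lt_one.trans hρi) hB0) hlam1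
  have hmR : R < ρ i / (1 - (μ : ℝ)) ^ m := by
    have hpos : (0 : ℝ) < (1 - μ) ^ m := pow_pos hlam0 m
    rw [lt_div_iff₀ hB0] at hm
    rw [lt_div_iff₀ hpos]
    nlinarith
  have hm1 : 1 < ρ i / (1 - (μ : ℝ)) ^ m := by
    have hpos : (0 : ℝ) < (1 - μ) ^ m := pow_pos hlam0 m
    rw [lt_div_iff₀' hpos]
    calc (1 - (μ : ℝ)) ^ m * 1 ≤ 1 := by
          rw [mul_one]; exact pow_le_one₀ hlam0.le hlam1.le
      _ < ρ i := hρi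
  -- iterate
  obtain ⟨Dm, Acc, hDm, hAcc, hwsDm, hvarDm, hwsAcc, hvarAcc, hcong⟩ :=
    s6_iter h2 h3 h4 h5 σ D hD ρ hρ hws N hN i hi μ hμ0 hμ1 hμρ m
  -- final weights
  set ρ' : ℕ → ℝ := Function.update (fun l => if N ≤ l then (ρ i - 1) / (μ : ℝ) else ρ l) i
      (ρ i / (1 - (μ : ℝ)) ^ m) with hρ'_def
  have hρ'i : ρ' i = ρ i / (1 - (μ : ℝ)) ^ m := by rw [hρ'_def, Function.update_self]
  have hρ'l : ∀ l, l ≠ i → ρ' l = if N ≤ l then (ρ i - 1) / (μ : ℝ) else ρ l := fun l hl => by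
    rw [hρ'_def, Function.update_of_ne hl]
  have hρ'1 : ∀ l, 1 < ρ' l := by
    intro l
    by_cases hli : l = i
    · rw [hli, hρ'i]; exact hm1
    · rw [hρ'l l hli]
      split_ifs
      · exact hΘ1
      · exact hρ l
  have hq : (((1 - μ : ℚ) : ℂ)) ^ m = ((((1 - μ) ^ m : ℚ)) : ℂ) := by push_cast; ring
  refine ⟨(((1 - μ : ℚ) : ℂ)) ^ m • Dm + Acc, ρ', N + m, ?_, hρ'1, ?_, Nat.le_add_right N m, ?_, ?_,
    ?_, ?_, hcong⟩
  · -- membership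
    refine add_mem_Oan σ ?_ hAcc
    rw [hq]
    exact s6_ratCast_smul_mem_Oan σ _ hDm
  · -- weights
    refine s6_ws_add (fun l => zero_le_one.trans (hρ'1 l).le) (s6_ws_smul _ ?_) ?_
    · refine s6_ws_congr (fun l hl => ?_) hwsDm
      by_cases hli : l = i
      · rw [hli, Function.update_self, hρ'i]
      · have hlN : l < N := hN l (hvarDm l hl)
        rw [Function.update_of_ne hli, hρ'l l hli, if_neg (by omega)]
    · refine s6_ws_congr (fun l hl => ?_) hwsAcc
      have hli : l ≠ i := by
        rcases hvarAcc l hl with ⟨-, h⟩ | ⟨h, -⟩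
        · exact h
        · omega
      rw [hρ'l l hli]
  · -- variables
    intro l hl
    rcases s6_usesVar_add hl with hl | hl
    · exact (hN l (hvarDm l (usesVar_of_smul hl))).trans_le (Nat.le_add_right N m)
    · rcases hvarAcc l hl with ⟨hlD, -⟩ | ⟨-, hlt⟩
      · exact (hN l hlD).trans_le (Nat.le_add_right N m)
      · exact hlt
  · -- unchanged weights
    intro l hlN hli
    rw [hρ'l l hli, if_neg (by omega)]
  · -- weight at `i`
    rw [hρ'i]; exact hmR
  · -- fresh weights
    intro l hNl _
    have hli : l ≠ i := by omega
    rw [hρ'l l hli, if_pos hNl]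
    exact hΘR

include h2 h3 h4 h5 in
/-- **All directions below `n` amplified** (induction on `n ≤ N` over `s6_axis`). [cite: Ayoub2015, Rem. 1.5] -/
theorem s6_axes (R : ℝ) (F : CSeries) (hF : F ∈ Oan σ) (ρ : ℕ → ℝ) (hρ : ∀ l, 1 < ρ l)
    (hws : Summable fun a : ℕ →₀ ℕ => ‖coeff a F‖ * a.prod fun l n => ρ l ^ n)
    (N : ℕ) (hN : ∀ l, UsesVar F l → l < N) (n : ℕ) (hn : n ≤ N) :
    ∃ (P : CSeries) (ρ' : ℕ → ℝ) (N' : ℕ), P ∈ Oan σ ∧ (∀ l, 1 < ρ' l) ∧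
      (Summable fun a : ℕ →₀ ℕ => ‖coeff a P‖ * a.prod fun l n => ρ' l ^ n) ∧ N ≤ N' ∧
      (∀ l, UsesVar P l → l < N') ∧ (∀ l, l < n → R < ρ' l) ∧
      (∀ l, N ≤ l → l < N' → R < ρ' l) ∧
      F - P ∈ kSpan σ {x : CSeries | ∃ G ∈ Oan σ, ∃ n : ℕ, x = relAC n G} := by
  induction n with
  | zero =>
    refine ⟨F, ρ, N, hF, hρ, hws, le_rfl, hN, fun l hl => absurd hl (Nat.not_lt_zero l),
      fun l h1 h2 => absurd (lt_of_le_of_lt h1 h2) (lt_irrefl N), ?_⟩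
    rw [sub_self]
    exact s6_zero_mem_kSpan σ _
  | succ n ih =>
    obtain ⟨P, ρ', N', hP, hρ', hwsP, hNN', hvarP, hgood, hfresh, hcong⟩ := ih (Nat.le_of_succ_le hn)
    have hnN' : n < N' := lt_of_lt_of_le (Nat.lt_of_succ_le hn) hNN'
    obtain ⟨P', ρ'', N'', hP', hρ'', hwsP', hN'N'', hvarP', hkeep, hgoodn, hfresh', hcong'⟩ :=
      s6_axis h2 h3 h4 h5 σ R P hP ρ' hρ' hwsP N' hvarP n hnN'
    refine ⟨P', ρ'', N'', hP', hρ'', hwsP', hNN'.trans hN'N'', hvarP', ?_, ?_, ?_⟩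
    · intro l hl
      rcases Nat.lt_succ_iff_lt_or_eq.mp hl with hl | rfl
      · rw [hkeep l (hl.trans hnN') hl.ne]
        exact hgood l hl
      · exact hgoodn
    · intro l hNl hlN''
      by_cases hlN' : l < N'
      · have hln : l ≠ n := by omega
        rw [hkeep l hlN' hln]
        exact hfresh l hNl hlN'
      · exact hfresh' l (not_lt.mp hlN') hlN''
    · have hsum : F - P' = (F - P) + (P - P') := by abel
      rw [hsum]
      exact kSpan_add σ hcong hcong'

end Main

/-- **S6 — THE ROOM LEMMA from the five steps (bookkeeping).** If transposition (S1), the room-step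
congruence (S2), the substituted-series facts (S3), the face-map facts (S4) and the dilated-piece
facts (S5) hold as stated, then for every `R` every `F ∈ 𝒪_{k-alg}(𝔻̄^∞)` is congruent modulo the
`k`-span of type (a) to some `P ∈ 𝒪_{k-alg}(𝔻̄^∞)` of polyradius `> R`. Proof: start from the
constant weights `r > 1` of `F` and its variable bound `N`; amplify the directions `0, …, N−1` in
turn (`s6_axes`, one fresh variable per room step); at the end every variable of `P` has weight
`> R`, and the minimum of these finitely many weights (capped by `max(R,0)+1`) is an isotropic radius
`> R` (`s6_iso`). S1 is not needed. [cite: Ayoub2015, Rem. 1.5] -/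
theorem stub_roomLemma_of :
    (∀ (k : Type) [Field k] [CharZero k] (σ : k →+* ℂ) (F : CSeries), F ∈ Oan σ →
      ∀ (i j : ℕ), i ≠ j → ¬ UsesVar F j →
        F - MvPowerSeries.rename (⇑(Equiv.swap i j)) F ∈
          kSpan σ {x : CSeries | ∃ G ∈ Oan σ, ∃ n : ℕ, x = relAC n G}) →
    (∀ (k : Type) [Field k] [CharZero k] (σ : k →+* ℂ) (F : CSeries), F ∈ Oan σ →
      ∀ (i j : ℕ), i ≠ j → ¬ UsesVar F j → ∀ (μ : ℚ),
        MvPowerSeries.subst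
            (fun l : ℕ => if l = i then (X i - C ((μ : ℚ) : ℂ) * (X i * X j) : CSeries) else X l) F ∈ Oan σ →
        F - ((((1 - μ : ℚ) : ℂ)) • MvPowerSeries.rescale (Function.update (1 : ℕ → ℂ) i ((1 - μ : ℚ) : ℂ)) F
              + ((μ : ℚ) : ℂ) • restrC i 1
                  (MvPowerSeries.subst
                    (fun l : ℕ => if l = i then (X i - C ((μ : ℚ) : ℂ) * (X i * X j) : CSeries) else X l) F)) ∈
          kSpan σ {x : CSeries | ∃ G ∈ Oan σ, ∃ n : ℕ, x = relAC n G}) →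
    (∀ (k : Type) [Field k] [CharZero k] (σ : k →+* ℂ) (F : CSeries), F ∈ Oan σ →
      ∀ (ρ : ℕ → ℝ), (∀ l, 1 < ρ l) →
        Summable (fun a : ℕ →₀ ℕ => ‖MvPowerSeries.coeff a F‖ * a.prod fun l n => ρ l ^ n) →
      ∀ (i j : ℕ), i ≠ j → ¬ UsesVar F j →
      ∀ (μ : ℚ), 0 < μ → ((μ : ℝ) < ρ i - 1) →
        MvPowerSeries.subst
            (fun l : ℕ => if l = i then (X i - C ((μ : ℚ) : ℂ) * (X i * X j) : CSeries) else X l) F ∈ Oan σ ∧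
        (∀ θi θj : ℝ, 0 ≤ θi → 0 ≤ θj → θi * (1 + (μ : ℝ) * θj) ≤ ρ i →
          Summable (fun a : ℕ →₀ ℕ =>
            ‖MvPowerSeries.coeff a (MvPowerSeries.subst
              (fun l : ℕ => if l = i then (X i - C ((μ : ℚ) : ℂ) * (X i * X j) : CSeries) else X l) F)‖ *
              a.prod fun l n => (Function.update (Function.update ρ i θi) j θj) l ^ n)) ∧
        (∀ l : ℕ, UsesVar (MvPowerSeries.subst
            (fun l : ℕ => if l = i then (X i - C ((μ : ℚ) : ℂ) * (X i * X j) : CSeries) else X l) F) l →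
          l = j ∨ UsesVar F l)) →
    (∀ (k : Type) [Field k] [CharZero k] (σ : k →+* ℂ) (G : CSeries), G ∈ Oan σ → ∀ (i : ℕ),
      restrC i 1 G ∈ Oan σ ∧ ¬ UsesVar (restrC i 1 G) i ∧
      (∀ l : ℕ, UsesVar (restrC i 1 G) l → UsesVar G l) ∧
      (∀ ρ : ℕ → ℝ, (∀ l, 1 ≤ ρ l) →
        Summable (fun a : ℕ →₀ ℕ => ‖MvPowerSeries.coeff a G‖ * a.prod fun l n => ρ l ^ n) →
        Summable (fun a : ℕ →₀ ℕ =>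
          ‖MvPowerSeries.coeff a (restrC i 1 G)‖ * a.prod fun l n => ρ l ^ n))) →
    (∀ (k : Type) [Field k] [CharZero k] (σ : k →+* ℂ) (F : CSeries), F ∈ Oan σ →
      ∀ (ρ : ℕ → ℝ), (∀ l, 1 < ρ l) →
        Summable (fun a : ℕ →₀ ℕ => ‖MvPowerSeries.coeff a F‖ * a.prod fun l n => ρ l ^ n) →
      ∀ (i : ℕ) (μ : ℚ), 0 < μ → μ < 1 →
        MvPowerSeries.rescale (Function.update (1 : ℕ → ℂ) i ((1 - μ : ℚ) : ℂ)) F ∈ Oan σ ∧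
        Summable (fun a : ℕ →₀ ℕ =>
          ‖MvPowerSeries.coeff a (MvPowerSeries.rescale (Function.update (1 : ℕ → ℂ) i ((1 - μ : ℚ) : ℂ)) F)‖ *
            a.prod fun l n => (Function.update ρ i (ρ i / (1 - (μ : ℝ)))) l ^ n) ∧
        (∀ l : ℕ, UsesVar (MvPowerSeries.rescale (Function.update (1 : ℕ → ℂ) i ((1 - μ : ℚ) : ℂ)) F) l →
          UsesVar F l)) →
    ∀ (k : Type) [Field k] [CharZero k] (σ : k →+* ℂ) (R : ℝ) (F : CSeries), F ∈ Oan σ →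
      ∃ P : CSeries, P ∈ Oan σ ∧
        (∃ r : ℝ, R < r ∧ Summable fun a : ℕ →₀ ℕ => ‖MvPowerSeries.coeff a P‖ * r ^ degree a) ∧
        F - P ∈ kSpan σ {x : CSeries | ∃ G ∈ Oan σ, ∃ n : ℕ, x = relAC n G} := by
  intro _h1 h2 h3 h4 h5 k _ _ σ R F hF
  classical
  obtain ⟨r, hr1, hws⟩ := s6_ws_of_mem_Oan σ hF
  obtain ⟨N, hNdep⟩ := hF.1
  have hN : ∀ l, UsesVar F l → l < N := fun l hl => s6_lt_of_usesVar hNdep hl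
  obtain ⟨P, ρ', N', hP, hρ', hwsP, -, hvarP, hgood, hfresh, hcong⟩ :=
    s6_axes h2 h3 h4 h5 σ R F hF (fun _ => r) (fun _ => hr1) hws N hN N le_rfl
  have hall : ∀ l, l < N' → R < ρ' l := fun l hl => by
    by_cases hlN : l < N
    · exact hgood l hlN
    · exact hfresh l (not_lt.mp hlN) hl
  -- the isotropic radius: the least of the finitely many weights, capped by `max R 0 + 1`
  set S : Finset ℝ := insert (max R 0 + 1) ((Finset.range N').image ρ') with hS_def
  have hSne : S.Nonempty := Finset.insert_nonempty _ _
  have hr₀R : R < S.min' hSne := by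
    rw [Finset.lt_min'_iff]
    intro y hy
    rcases Finset.mem_insert.mp hy with rfl | hy
    · exact (le_max_left R 0).trans_lt (lt_add_one _)
    · obtain ⟨l, hl, rfl⟩ := Finset.mem_image.mp hy
      exact hall l (Finset.mem_range.mp hl)
  have hr₀0 : 0 ≤ S.min' hSne := by
    rw [Finset.le_min'_iff]
    intro y hy
    rcases Finset.mem_insert.mp hy with rfl | hy
    · exact (le_max_right R 0).trans (le_add_of_nonneg_right zero_le_one)
    · obtain ⟨l, _, rfl⟩ := Finset.mem_image.mp hy
      exact zero_le_one.trans (hρ' l).le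
  have hr₀le : ∀ l, l < N' → S.min' hSne ≤ ρ' l := fun l hl =>
    Finset.min'_le S _ (Finset.mem_insert_of_mem (Finset.mem_image_of_mem ρ' (Finset.mem_range.mpr hl)))
  exact ⟨P, hP, ⟨S.min' hSne, hr₀R, s6_iso hvarP hr₀0 hr₀le hwsP⟩, hcong⟩

end Summit.KontsevichZagierPeriods.KontsevichZagierPeriods.TypeAGenerationLine
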